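import Summits.Ventures.HSemireg.WedgeHankelRecurrenceGaussMarkovParameter

/-!
# Venture HSemireg — **TRACE BALANCE OF THE ZEROS UNDER A CHANGE OF THE RECURRENCE**: for any two recurrences the zeros of `q_{t+1}` and `q'_{t+1}` satisfy `Σ_k (y_k − x_k) = Σ_{i≤t} (a'_i − a_i)`
# and `Σ_k (y_k² − x_k²) = Σ_{i≤t} (a'_i² − a_i²) + 2 Σ_{j=1}^{t} (b'_j − b_j)` (Vieta ∕ Newton sums, N298); hence a pure change of COUPLINGS keeps the centroid of the zeros and changes their
# spread by exactly `2 Σ (b'_j − b_j)` (it grows when the couplings grow — the quantitative companion of N325 ∕ N349 and of the examples N348), and raising ONE diagonal coefficient by `c`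
# displaces the zeros by non-negative amounts `y_k − x_k` summing to `c` (so each is `≤ c`)

HONEST FRAMING. Part of the Lean index of the computation cell `pub-hsemireg` (seat p10 gen 45, Sunday typer «UNIFORM-IN-n»).  Finite sums and real polynomials only; no variety, no cohomology
theory, no sheaf, no Ext group and no semiregularity map is constructed here; nothing here says that HC / HC_CM / HC_AV holds; no Literature fact (unproved `Prop`) is declared or used.  Custodian
versions as in `WedgeHankelSiegelIdeal` (1/3).
SOURCES (cited).  T. S. Chihara, *An Introduction to Orthogonal Polynomials* (1978) Ch. I (4.13)–(4.14) (first two Newton sums of the zeros from the recurrence); B. N. Parlett, *The Symmetric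
Eigenvalue Problem* (1980) §10.3 (rank-one changes: `Σ (λ'_k − λ_k) = tr`); A. J. Hoffman, H. W. Wielandt, Duke Math. J. 20 (1953) 37–39 (context: `Σ (λ'_k − λ_k)² ≤ ‖E‖_F²`, not typed here).
PROOF TYPED HERE.  N298 `sum_recurrence_zeros` ∕ `sum_recurrence_zeros_sq` for both recurrences and subtraction; the rank-one sum collapses to `c`; non-negativity of each displacement is N323
`zeros_mono_diagonal`, and a sum of non-negative terms bounds each term.
DEDUP DISCLOSURE (`rg -n 'trace_balance|centroid|displacement' Summits/Ventures/HSemireg`, 2026-09-03): N298 has the one-recurrence Newton sums, N330 uses them for spread bounds; the two-recurrence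
balances are new.  The 6 names below: 0 hits tree-wide.

WHAT IS IN THE TREE.  N298 `sum_recurrence_zeros`, `sum_recurrence_zeros_sq`; N323 `zeros_mono_diagonal`; N346 `zeros_rank_one_interlace`.
THIS FILE (namespace `Summit.Ventures.HSemireg.Wedge.HankelOuter` continued; CHAINED on N352 (import only); 0 definitions):
* §1118 **`zeros_sum_balance`** (`Σ y_k − Σ x_k = Σ_{i≤t} (a'_i − a_i)`), **`zeros_sq_sum_balance`** (`Σ y_k² − Σ x_k² = Σ (a'_i² − a_i²) + 2 Σ (b'_j − b_j)`, `t ≥ 1`), **`zeros_centroid_fixed_of_couplings`**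
  (`a = a'` ⇒ `Σ y_k = Σ x_k`), **`zeros_spread_balance_of_couplings`** (`a = a'` ⇒ `Σ y_k² − Σ x_k² = 2 Σ (b'_j − b_j)`, positive when `b ≤ b'` with one strict inequality),
  **`rank_one_displacements_sum`** (one `a_i` raised by `c`, `i ≤ t`: `Σ_k (y_k − x_k) = c`), **`rank_one_displacement_le`** (`0 ≤ y_k − x_k ≤ c`).
CAVEATS.  Recurrence algebra; positivity of `b` only where N323 is invoked.  Nothing Ext-side.  New names only.
-/

open Module Polynomial
open scoped Matrix Polynomial

namespace Summit.Ventures.HSemireg.Wedge.HankelOuter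

/-! ## §1118. Trace balance of the zeros -/

/-- **`Σ_k y_k − Σ_k x_k = Σ_{i≤t} (a'_i − a_i)`** for the zeros of `q_{t+1}` (recurrence `(a, b)`) and `q'_{t+1}` (recurrence `(a', b')`). [Chihara I (4.13); Parlett §10.3; this file, §1118] -/
theorem zeros_sum_balance {q q' : ℕ → ℝ[X]} {a a' b b' : ℕ → ℝ} (hq0 : q 0 = 1) (hq1 : q 1 = Polynomial.X - C (a 0))
    (hrec : ∀ n, q (n + 2) = (Polynomial.X - C (a (n + 1))) * q (n + 1) - C (b (n + 1)) * q n)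
    (hq0' : q' 0 = 1) (hq1' : q' 1 = Polynomial.X - C (a' 0)) (hrec' : ∀ n, q' (n + 2) = (Polynomial.X - C (a' (n + 1))) * q' (n + 1) - C (b' (n + 1)) * q' n)
    {t : ℕ} {x y : Fin (t + 1) → ℝ} (hxq : q (t + 1) = ∏ j, (Polynomial.X - C (x j))) (hyq : q' (t + 1) = ∏ j, (Polynomial.X - C (y j))) :
    ∑ k, y k - ∑ k, x k = ∑ i ∈ Finset.range (t + 1), (a' i - a i) := by
  rw [sum_recurrence_zeros hq0 hq1 hrec hxq, sum_recurrence_zeros hq0' hq1' hrec' hyq, Finset.sum_sub_distrib]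

/-- **`Σ_k y_k² − Σ_k x_k² = Σ_{i≤m+1} (a'_i² − a_i²) + 2 Σ_{i≤m} (b'_{i+1} − b_{i+1})`** for the zeros of `q_{m+2}` and `q'_{m+2}`. [Chihara I (4.14); this file, §1118] -/
theorem zeros_sq_sum_balance {q q' : ℕ → ℝ[X]} {a a' b b' : ℕ → ℝ} (hq0 : q 0 = 1) (hq1 : q 1 = Polynomial.X - C (a 0))
    (hrec : ∀ n, q (n + 2) = (Polynomial.X - C (a (n + 1))) * q (n + 1) - C (b (n + 1)) * q n)
    (hq0' : q' 0 = 1) (hq1' : q' 1 = Polynomial.X - C (a' 0)) (hrec' : ∀ n, q' (n + 2) = (Polynomial.X - C (a' (n + 1))) * q' (n + 1) - C (b' (n + 1)) * q' n)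
    {m : ℕ} {x y : Fin (m + 2) → ℝ} (hxq : q (m + 2) = ∏ j, (Polynomial.X - C (x j))) (hyq : q' (m + 2) = ∏ j, (Polynomial.X - C (y j))) :
    ∑ k, y k ^ 2 - ∑ k, x k ^ 2 = ∑ i ∈ Finset.range (m + 2), (a' i ^ 2 - a i ^ 2) + 2 * ∑ i ∈ Finset.range (m + 1), (b' (i + 1) - b (i + 1)) := by
  rw [sum_recurrence_zeros_sq hq0 hq1 hrec hxq, sum_recurrence_zeros_sq hq0' hq1' hrec' hyq, Finset.sum_sub_distrib, Finset.sum_sub_distrib]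
  ring

/-- **A CHANGE OF THE COUPLINGS ONLY KEEPS THE CENTROID OF THE ZEROS: `a = a'` ⇒ `Σ y_k = Σ x_k`.** [this file, §1118] -/
theorem zeros_centroid_fixed_of_couplings {q q' : ℕ → ℝ[X]} {a b b' : ℕ → ℝ} (hq0 : q 0 = 1) (hq1 : q 1 = Polynomial.X - C (a 0))
    (hrec : ∀ n, q (n + 2) = (Polynomial.X - C (a (n + 1))) * q (n + 1) - C (b (n + 1)) * q n)
    (hq0' : q' 0 = 1) (hq1' : q' 1 = Polynomial.X - C (a 0)) (hrec' : ∀ n, q' (n + 2) = (Polynomial.X - C (a (n + 1))) * q' (n + 1) - C (b' (n + 1)) * q' n)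
    {t : ℕ} {x y : Fin (t + 1) → ℝ} (hxq : q (t + 1) = ∏ j, (Polynomial.X - C (x j))) (hyq : q' (t + 1) = ∏ j, (Polynomial.X - C (y j))) :
    ∑ k, y k = ∑ k, x k := by
  have h := zeros_sum_balance hq0 hq1 hrec hq0' hq1' hrec' hxq hyq
  simp only [sub_self, Finset.sum_const_zero] at h
  linarith

/-- **… AND CHANGES THEIR SPREAD BY EXACTLY `2 Σ (b'_j − b_j)`: `a = a'` ⇒ `Σ y_k² − Σ x_k² = 2 Σ_{i≤m} (b'_{i+1} − b_{i+1})`; in particular `Σ x_k² < Σ y_k²` when `b_j ≤ b'_j` for `1 ≤ j ≤ m + 1`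
with one strict inequality** (the couplings spread the zeros in mean square while the centroid stays; cf. N325 ∕ N349 for the extreme zeros, N348 for the interior ones). [this file, §1118] -/
theorem zeros_spread_balance_of_couplings {q q' : ℕ → ℝ[X]} {a b b' : ℕ → ℝ} (hq0 : q 0 = 1) (hq1 : q 1 = Polynomial.X - C (a 0))
    (hrec : ∀ n, q (n + 2) = (Polynomial.X - C (a (n + 1))) * q (n + 1) - C (b (n + 1)) * q n)
    (hq0' : q' 0 = 1) (hq1' : q' 1 = Polynomial.X - C (a 0)) (hrec' : ∀ n, q' (n + 2) = (Polynomial.X - C (a (n + 1))) * q' (n + 1) - C (b' (n + 1)) * q' n)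
    {m : ℕ} {x y : Fin (m + 2) → ℝ} (hxq : q (m + 2) = ∏ j, (Polynomial.X - C (x j))) (hyq : q' (m + 2) = ∏ j, (Polynomial.X - C (y j))) :
    ∑ k, y k ^ 2 - ∑ k, x k ^ 2 = 2 * ∑ i ∈ Finset.range (m + 1), (b' (i + 1) - b (i + 1)) ∧
      ((∀ j, 1 ≤ j → j ≤ m + 1 → b j ≤ b' j) → ∀ {j₀ : ℕ}, 1 ≤ j₀ → j₀ ≤ m + 1 → b j₀ < b' j₀ → ∑ k, x k ^ 2 < ∑ k, y k ^ 2) := by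
  have h := zeros_sq_sum_balance hq0 hq1 hrec hq0' hq1' hrec' hxq hyq
  simp only [sub_self, Finset.sum_const_zero, zero_add] at h
  refine ⟨h, fun hbb' j₀ hj₀ hj₀m hlt => ?_⟩
  have hpos : 0 < ∑ i ∈ Finset.range (m + 1), (b' (i + 1) - b (i + 1)) :=
    Finset.sum_pos' (fun i hi => sub_nonneg.2 (hbb' (i + 1) (by omega) (by have := Finset.mem_range.1 hi; omega)))
      ⟨j₀ - 1, Finset.mem_range.2 (by omega), by rw [show j₀ - 1 + 1 = j₀ by omega]; exact sub_pos.2 hlt⟩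
  linarith

/-- **RANK ONE: the displacements sum to `c`.**  `a'_i = a_i + c` for one index `i ≤ t`, all other coefficients equal ⇒ `Σ_k (y_k − x_k) = c`. [Parlett §10.3; this file, §1118] -/
theorem rank_one_displacements_sum {q q' : ℕ → ℝ[X]} {a a' b : ℕ → ℝ} (hq0 : q 0 = 1) (hq1 : q 1 = Polynomial.X - C (a 0))
    (hrec : ∀ n, q (n + 2) = (Polynomial.X - C (a (n + 1))) * q (n + 1) - C (b (n + 1)) * q n)
    (hq0' : q' 0 = 1) (hq1' : q' 1 = Polynomial.X - C (a' 0)) (hrec' : ∀ n, q' (n + 2) = (Polynomial.X - C (a' (n + 1))) * q' (n + 1) - C (b (n + 1)) * q' n)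
    {i : ℕ} {c : ℝ} (hc : a' i = a i + c) (ha : ∀ n, n ≠ i → a' n = a n) {t : ℕ} (hit : i ≤ t)
    {x y : Fin (t + 1) → ℝ} (hxq : q (t + 1) = ∏ j, (Polynomial.X - C (x j))) (hyq : q' (t + 1) = ∏ j, (Polynomial.X - C (y j))) :
    ∑ k, (y k - x k) = c := by
  rw [Finset.sum_sub_distrib, zeros_sum_balance hq0 hq1 hrec hq0' hq1' hrec' hxq hyq, Finset.sum_eq_single i (fun n _ hn => by rw [ha n hn, sub_self])
    (fun h => absurd (Finset.mem_range.2 (Nat.lt_succ_of_le hit)) h), hc, add_sub_cancel_left]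

/-- **… and each displacement lies in `[0, c]`** (`c ≥ 0`, `b > 0`). [Weyl; Parlett §10.3; this file, §1118] -/
theorem rank_one_displacement_le {q q' : ℕ → ℝ[X]} {a a' b : ℕ → ℝ} (hq0 : q 0 = 1) (hq1 : q 1 = Polynomial.X - C (a 0))
    (hrec : ∀ n, q (n + 2) = (Polynomial.X - C (a (n + 1))) * q (n + 1) - C (b (n + 1)) * q n)
    (hq0' : q' 0 = 1) (hq1' : q' 1 = Polynomial.X - C (a' 0)) (hrec' : ∀ n, q' (n + 2) = (Polynomial.X - C (a' (n + 1))) * q' (n + 1) - C (b (n + 1)) * q' n)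
    (hb : ∀ j, 0 < b j) {i : ℕ} {c : ℝ} (hc : a' i = a i + c) (hc0 : 0 ≤ c) (ha : ∀ n, n ≠ i → a' n = a n) {t : ℕ} (hit : i ≤ t)
    {x y : Fin (t + 1) → ℝ} (hx : StrictMono x) (hxq : q (t + 1) = ∏ j, (Polynomial.X - C (x j))) (hy : StrictMono y) (hyq : q' (t + 1) = ∏ j, (Polynomial.X - C (y j)))
    (k : Fin (t + 1)) : 0 ≤ y k - x k ∧ y k - x k ≤ c := by
  have hnonneg : ∀ k, 0 ≤ y k - x k := fun k =>
    sub_nonneg.2 (zeros_rank_one_interlace hq0 hq1 hrec hq0' hq1' hrec' hb (i₀ := i) (by rw [hc]; exact le_add_of_nonneg_right hc0) ha hx hxq hy hyq k).1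
  refine ⟨hnonneg k, ?_⟩
  rw [← rank_one_displacements_sum hq0 hq1 hrec hq0' hq1' hrec' hc ha hit hxq hyq]
  exact Finset.single_le_sum (fun k _ => hnonneg k) (Finset.mem_univ k)

end Summit.Ventures.HSemireg.Wedge.HankelOuter
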